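import Summits.Ventures.HodgeRepro2.T5BergmanCoeffOrtho

/-!
# The `L²`-theory of the matrix coefficients: the `K`-type expansion of `∫ |⟨π_k(g) f, h⟩_k|² dμ`

Fix `k ≥ 2`, `h ∈ A_k` and a Haar measure `μ` on `SU(1,1)`; write `c_f(g) = ⟨π_k(g) f, h⟩_k` and
`Q(f) = ∫ |c_f|² dμ`. The main theorem (`hasSum_integral_norm_matrixCoeff_sq`) is the **expansion along
the `K`-types**: for holomorphic `f = Σ a_m zᵐ ∈ A_k` with `c_f ∈ L²(μ)`,

  `Q(f) = Σ_m |a_m|² Q(zᵐ)`   (as a `HasSum`),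

and conversely `c_f ∈ L²(μ)` as soon as the right-hand side converges
(`integrable_norm_matrixCoeff_sq_of_summable`). The ingredients:

* **`K`-averaging** (`integral_integral_mul_rot`): `∫_G ∫_K F(g · rot u) du dμ(g) = ∫_G F dμ` for
  integrable continuous `F`, by Fubini and the right-invariance of `μ` (`SU(1,1)` is unimodular);
* **the a priori bound** (`norm_sq_mul_integral_monomial_le`): `|c_m|² Q(zᵐ) ≤ Q(φ)` for
  `φ = Σ c_m zᵐ` with `c_φ ∈ L²` — the `K`-type projection `∫_K u^{k+2m} c_φ(g · rot u) du = c_m c_{zᵐ}(g)`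
  (`integral_circle_pow_mul_matrixCoeff`) and Jensen's inequality on the circle; applied to the coherent
  state `φ = K_{1/2}` (whose coefficient is a right translate of the lowest-weight coefficient,
  `matrixCoeff_kernel_eq`) it shows that EVERY monomial coefficient is square-integrable
  (`integrable_norm_matrixCoeff_monomial_sq`);
* **Fatou** (`lintegral_norm_matrixCoeff_sq_le`): `∫⁻ |c_f|² ≤ Σ_m |a_m|² Q(zᵐ)` — the Taylor polynomials
  `S_N f` converge to `f` and `c_{S_N f} → c_f` pointwise;
* **Bessel** (`sum_le_integral_norm_matrixCoeff_sq`): `Σ_{m<N} |a_m|² Q(zᵐ) ≤ Q(f)` — the cross term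
  `∫ c_{S_N f} conj c_{f - S_N f} dμ` vanishes (`integral_partialSum_mul_conj_sub_eq_zero`), because after
  `K`-averaging only the `K`-types `m < N` of `f - S_N f` survive, and those are zero.

Blind lane: Mathlib + the HodgeRepro2 prefix only; no sorry; axioms ⊆ {propext, Classical.choice,
Quot.sound}.
-/

namespace Summit.Ventures.HodgeRepro2.T5BergmanCoeffL2

open MeasureTheory MeasureTheory.Measure Metric Filter Topology
open T5PoincareDensity T5SU11Unimodular T5SU11Fibration T5HaarCircle
open T5BergmanCoefficient T5BergmanPairing T5BergmanUnitary T5BergmanFourier T5BergmanKernel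
  T5BergmanParseval T5BergmanPointwise T5BergmanProjection T5BergmanCoefficientL2 T5BergmanKTypes
  T5BergmanActStable T5BergmanMatrixCoeff T5BergmanCoeffOrtho T5BergmanSchur
open scoped Real ENNReal

variable [MeasurableSpace Circle] [BorelSpace Circle]

/-! ### Jensen on the circle and `K`-averaging on the group -/

/-- Continuous functions on the circle are integrable against the normalised Haar measure. -/
lemma integrable_circle_of_continuous {E : Type*} [NormedAddCommGroup E] {F : Circle → E}
    (hF : Continuous F) : Integrable F haarCircle :=
  hF.integrable_of_hasCompactSupport (HasCompactSupport.of_compactSpace _)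

/-- **Jensen's inequality on the circle**: `|∫_K F du|² ≤ ∫_K |F|² du` for continuous `F`. -/
theorem norm_integral_circle_sq_le (F : Circle → ℂ) (hF : Continuous F) :
    ‖∫ u, F u ∂haarCircle‖ ^ 2 ≤ ∫ u, ‖F u‖ ^ 2 ∂haarCircle := by
  have h1 : ‖∫ u, F u ∂haarCircle‖ ≤ ∫ u, ‖F u‖ ∂haarCircle := norm_integral_le_integral_norm F
  have hi1 : Integrable (fun u => ‖F u‖) haarCircle := integrable_circle_of_continuous hF.norm
  have hi2 : Integrable (fun u => ‖F u‖ ^ 2) haarCircle :=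
    integrable_circle_of_continuous (hF.norm.pow 2)
  set c := ∫ u, ‖F u‖ ∂haarCircle with hc
  have h2 : 0 ≤ ∫ u, (‖F u‖ - c) ^ 2 ∂haarCircle := integral_nonneg fun u => sq_nonneg _
  have h3 : ∫ u, (‖F u‖ - c) ^ 2 ∂haarCircle = ∫ u, ‖F u‖ ^ 2 ∂haarCircle - c ^ 2 := by
    have hi3 : Integrable (fun u => (2 * c) * ‖F u‖) haarCircle := hi1.const_mul _
    have hi23 : Integrable (fun u => ‖F u‖ ^ 2 - (2 * c) * ‖F u‖) haarCircle := hi2.sub hi3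
    have e1 : ∫ u, (‖F u‖ - c) ^ 2 ∂haarCircle =
        ∫ u, ((‖F u‖ ^ 2 - (2 * c) * ‖F u‖) + c ^ 2) ∂haarCircle := by
      congr 1
      funext u
      ring
    rw [e1, integral_add hi23 (integrable_const _), integral_sub hi2 hi3, integral_const_mul,
      integral_const, measureReal_def, haarCircle_univ, ENNReal.toReal_one, one_smul, ← hc]
    ring
  calc ‖∫ u, F u ∂haarCircle‖ ^ 2 ≤ c ^ 2 := pow_le_pow_left₀ (norm_nonneg _) h1 2
    _ ≤ ∫ u, ‖F u‖ ^ 2 ∂haarCircle := by linarith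

/-- The function `(g, u) ↦ F (g · rot u)` is integrable on `G × K` for integrable continuous `F`. -/
theorem integrable_uncurry_mul_rot (μ : Measure SU11) [IsHaarMeasure μ] {E : Type*}
    [NormedAddCommGroup E] {F : SU11 → E} (hF : Continuous F) (hFi : Integrable F μ) :
    Integrable (Function.uncurry fun (g : SU11) (u : Circle) => F (g * rot u))
      (μ.prod haarCircle) := by
  haveI := isMulRightInvariant μ
  have hmeas : AEStronglyMeasurable (Function.uncurry fun (g : SU11) (u : Circle) => F (g * rot u))
      (μ.prod haarCircle) :=
    (hF.comp (continuous_fst.mul (continuous_rot.comp continuous_snd))).aestronglyMeasurable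
  rw [integrable_prod_iff' hmeas]
  refine ⟨Eventually.of_forall fun u => hFi.comp_mul_right (rot u), ?_⟩
  have e : ∀ u : Circle, ∫ g, ‖F (g * rot u)‖ ∂μ = ∫ g, ‖F g‖ ∂μ := fun u =>
    integral_mul_right μ (fun g => ‖F g‖) (rot u)
  simp only [Function.uncurry_apply_pair]
  simp_rw [e]
  exact integrable_const _

/-- **`K`-averaging**: `∫_G (∫_K F(g · rot u) du) dμ(g) = ∫_G F dμ` for integrable continuous `F`
(Fubini and the right-invariance of the Haar measure of the unimodular group `SU(1,1)`). -/
theorem integral_integral_mul_rot (μ : Measure SU11) [IsHaarMeasure μ] {E : Type*}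
    [NormedAddCommGroup E] [NormedSpace ℝ E] [CompleteSpace E] {F : SU11 → E} (hF : Continuous F)
    (hFi : Integrable F μ) :
    ∫ g, ∫ u, F (g * rot u) ∂haarCircle ∂μ = ∫ g, F g ∂μ := by
  rw [integral_integral_swap (integrable_uncurry_mul_rot μ hF hFi)]
  have e : ∀ u : Circle, ∫ g, F (g * rot u) ∂μ = ∫ g, F g ∂μ := fun u =>
    integral_mul_right μ F (rot u)
  simp_rw [e]
  rw [integral_const, measureReal_def, haarCircle_univ, ENNReal.toReal_one, one_smul]

/-! ### The a priori bound and the square-integrability of the monomial coefficients -/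

/-- **The a priori bound**: for `φ = Σ c_m zᵐ ∈ A_k` holomorphic with `c_φ ∈ L²(μ)`, every monomial
coefficient satisfies `|c_m|² ∫ |c_{zᵐ}|² dμ ≤ ∫ |c_φ|² dμ` (and the left integrand is integrable). -/
theorem norm_sq_mul_integral_monomial_le (μ : Measure SU11) [IsHaarMeasure μ] (k : ℕ) (hk : 2 ≤ k)
    (c : ℕ → ℂ) (φ : ℂ → ℂ) (hφ : DifferentiableOn ℂ φ (ball 0 1))
    (hφc : ∀ w ∈ ball (0 : ℂ) 1, HasSum (fun m => c m * w ^ m) (φ w))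
    (hφint : IntegrableOn (fun w => ‖φ w‖ ^ 2 * (1 - ‖w‖ ^ 2) ^ (k - 2)) (ball (0 : ℂ) 1))
    (b : ℕ → ℂ) (h : ℂ → ℂ) (hh : ∀ w ∈ ball (0 : ℂ) 1, HasSum (fun n => b n * w ^ n) (h w))
    (hhint : IntegrableOn (fun w => ‖h w‖ ^ 2 * (1 - ‖w‖ ^ 2) ^ (k - 2)) (ball (0 : ℂ) 1))
    (hφ2 : Integrable (fun g => ‖matrixCoeff k φ h g‖ ^ 2) μ) (m : ℕ) :
    Integrable (fun g => ‖c m‖ ^ 2 * ‖matrixCoeff k (fun w => w ^ m) h g‖ ^ 2) μ ∧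
      ‖c m‖ ^ 2 * ∫ g, ‖matrixCoeff k (fun w => w ^ m) h g‖ ^ 2 ∂μ ≤
        ∫ g, ‖matrixCoeff k φ h g‖ ^ 2 ∂μ := by
  have hcont : Continuous (matrixCoeff k φ h) := continuous_matrixCoeff k hk c φ hφ hφc hφint b h hh hhint
  have hcm : Continuous (matrixCoeff k (fun w => w ^ m) h) :=
    continuous_matrixCoeff_monomial k hk m b h hh hhint
  -- the averaged function
  set A : SU11 → ℝ := fun g => ∫ u, ‖matrixCoeff k φ h (g * rot u)‖ ^ 2 ∂haarCircle with hA
  have hprod := integrable_uncurry_mul_rot μ (hcont.norm.pow 2) hφ2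
  have hAi : Integrable A μ := hprod.integral_prod_left
  have hAint : ∫ g, A g ∂μ = ∫ g, ‖matrixCoeff k φ h g‖ ^ 2 ∂μ :=
    integral_integral_mul_rot μ (hcont.norm.pow 2) hφ2
  -- the pointwise bound through the `K`-type projection and Jensen
  have hpt : ∀ g, ‖c m‖ ^ 2 * ‖matrixCoeff k (fun w => w ^ m) h g‖ ^ 2 ≤ A g := by
    intro g
    rw [← mul_pow, ← norm_mul, ← integral_circle_pow_mul_matrixCoeff k hk c φ hφ hφc hφint b h hh hhint m g]
    refine (norm_integral_circle_sq_le _ ?_).trans (le_of_eq ?_)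
    · exact (by fun_prop : Continuous fun u : Circle => (u : ℂ) ^ (k + 2 * m)).mul
        (hcont.comp (continuous_const.mul continuous_rot))
    · rw [hA]
      simp only
      congr 1
      funext u
      rw [norm_mul, norm_pow, Circle.norm_coe, one_pow, one_mul]
  have hint : Integrable (fun g => ‖c m‖ ^ 2 * ‖matrixCoeff k (fun w => w ^ m) h g‖ ^ 2) μ := by
    refine hAi.mono' (continuous_const.mul (hcm.norm.pow 2)).aestronglyMeasurable
      (Eventually.of_forall fun g => ?_)
    rw [Real.norm_eq_abs, abs_of_nonneg (by positivity)]
    exact hpt g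
  refine ⟨hint, ?_⟩
  rw [← integral_const_mul, ← hAint]
  exact integral_mono hint hAi hpt

omit [MeasurableSpace Circle] [BorelSpace Circle] in
/-- **The coefficient of a coherent state is a right translate of the lowest-weight coefficient**:
`⟨π_k(g) K_z, h⟩_k = a_z^k ⟨π_k(g · s(z)) 1, h⟩_k` with `a_z = mat (sec z) 0 0`, `z ∈ 𝔻`. -/
theorem matrixCoeff_kernel_eq (k : ℕ) {z : ℂ} (hz : z ∈ ball (0 : ℂ) 1) (h : ℂ → ℂ) (g : SU11) :
    matrixCoeff k (kernel k z) h g = (mat (sec z) 0 0) ^ k * coeffLowest k h (g * sec z) := by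
  have ha : mat (sec z) 0 0 ≠ 0 := mat_zero_zero_ne_zero (sec z)
  have e : ∀ w, kernel k z w = (mat (sec z) 0 0) ^ k * act k (sec z) lowest w := by
    intro w
    rw [act_lowest_eq_kernel k (sec z) w, orbit_sec hz, ← mul_assoc, ← mul_pow, mul_inv_cancel₀ ha,
      one_pow, one_mul]
  rw [matrixCoeff_congr (fun w _ => e w) (fun _ _ => rfl) g, matrixCoeff_const_mul_left,
    ← matrixCoeff_mul, matrixCoeff_lowest]

omit [MeasurableSpace Circle] [BorelSpace Circle] in
/-- The coherent states are holomorphic on the disc. -/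
lemma differentiableOn_kernel (k : ℕ) {z : ℂ} (hz : z ∈ ball (0 : ℂ) 1) :
    DifferentiableOn ℂ (kernel k z) (ball 0 1) := by
  unfold kernel
  refine DifferentiableOn.pow (DifferentiableOn.inv ?_ ?_) k
  · fun_prop
  · intro w hw
    exact one_sub_conj_mul_ne_zero hz (ball_subset_closedBall hw)

omit [MeasurableSpace Circle] [BorelSpace Circle] in
/-- The coherent states lie in `A_k`. -/
lemma integrableOn_kernel (k : ℕ) {z : ℂ} (hz : z ∈ ball (0 : ℂ) 1) :
    IntegrableOn (fun w => ‖kernel k z w‖ ^ 2 * (1 - ‖w‖ ^ 2) ^ (k - 2)) (ball (0 : ℂ) 1) :=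
  integrableOn_sq_weight_of_continuousOn k (continuousOn_kernel k hz)

/-- **The coefficient of a coherent state is square-integrable** against every Haar measure, with
`∫ |⟨π_k(g) K_z, h⟩_k|² dμ = |a_z|^{2k} ∫ |⟨π_k(g) 1, h⟩_k|² dμ`. -/
theorem integrable_norm_matrixCoeff_kernel_sq (μ : Measure SU11) [IsHaarMeasure μ] (k : ℕ) (hk : 2 ≤ k)
    {z : ℂ} (hz : z ∈ ball (0 : ℂ) 1) (b : ℕ → ℂ) (h : ℂ → ℂ)
    (hh : ∀ w ∈ ball (0 : ℂ) 1, HasSum (fun n => b n * w ^ n) (h w))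
    (hhint : IntegrableOn (fun w => ‖h w‖ ^ 2 * (1 - ‖w‖ ^ 2) ^ (k - 2)) (ball (0 : ℂ) 1)) :
    Integrable (fun g => ‖matrixCoeff k (kernel k z) h g‖ ^ 2) μ ∧
      ∫ g, ‖matrixCoeff k (kernel k z) h g‖ ^ 2 ∂μ =
        ‖mat (sec z) 0 0‖ ^ (2 * k) * ∫ g, ‖coeffLowest k h g‖ ^ 2 ∂μ := by
  haveI := isMulRightInvariant μ
  have e : ∀ g, ‖matrixCoeff k (kernel k z) h g‖ ^ 2 =
      ‖mat (sec z) 0 0‖ ^ (2 * k) * ‖coeffLowest k h (g * sec z)‖ ^ 2 := by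
    intro g
    rw [matrixCoeff_kernel_eq k hz h g, norm_mul, mul_pow, norm_pow, ← pow_mul, mul_comm k 2]
  simp_rw [e]
  refine ⟨((integrable_norm_coeffLowest_sq μ k hk b h hh hhint).comp_mul_right (sec z)).const_mul _, ?_⟩
  rw [integral_const_mul, integral_mul_right μ (fun g => ‖coeffLowest k h g‖ ^ 2) (sec z)]

/-- **Every monomial coefficient is square-integrable** against every Haar measure, for `h ∈ A_k`
(the a priori bound applied to the coherent state `K_{1/2}`). -/
theorem integrable_norm_matrixCoeff_monomial_sq (μ : Measure SU11) [IsHaarMeasure μ] (k : ℕ)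
    (hk : 2 ≤ k) (b : ℕ → ℂ) (h : ℂ → ℂ)
    (hh : ∀ w ∈ ball (0 : ℂ) 1, HasSum (fun n => b n * w ^ n) (h w))
    (hhint : IntegrableOn (fun w => ‖h w‖ ^ 2 * (1 - ‖w‖ ^ 2) ^ (k - 2)) (ball (0 : ℂ) 1)) (m : ℕ) :
    Integrable (fun g => ‖matrixCoeff k (fun w => w ^ m) h g‖ ^ 2) μ := by
  have hz : ((1 / 2 : ℝ) : ℂ) ∈ ball (0 : ℂ) 1 := by
    rw [mem_ball_zero_iff, Complex.norm_real, Real.norm_eq_abs]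
    norm_num
  have hφ2 := (integrable_norm_matrixCoeff_kernel_sq μ k hk hz b h hh hhint).1
  have key := (norm_sq_mul_integral_monomial_le μ k hk (kernelCoeff k _) (kernel k _)
    (differentiableOn_kernel k hz) (fun w hw => hasSum_kernel k hk hz hw) (integrableOn_kernel k hz)
    b h hh hhint hφ2 m).1
  have hc : ‖kernelCoeff k ((1 / 2 : ℝ) : ℂ) m‖ ≠ 0 := by
    unfold kernelCoeff
    rw [norm_mul, norm_pow, Complex.norm_conj, Complex.norm_real, Real.norm_eq_abs, Complex.norm_natCast]
    have : 0 < ((m + k - 1).choose m : ℝ) := by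
      have := Nat.choose_pos (show m ≤ m + k - 1 by omega)
      exact_mod_cast this
    positivity
  have := key.const_mul (‖kernelCoeff k ((1 / 2 : ℝ) : ℂ) m‖ ^ 2)⁻¹
  refine this.congr (Eventually.of_forall fun g => ?_)
  simp only
  field_simp

end Summit.Ventures.HodgeRepro2.T5BergmanCoeffL2
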